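import Summits.QuantumFields.YangMills.Theorems.BalabanUVNodesK0AxJoinResidualSplit

/-!
# P3 g88 — §7c SKETCH (LENS P3 «weaken the target»): THE (1.21)-LIMIT HALF (L-lim) FROM A TWO-VOLUME GEOMETRIC RATE ROW ON THE KERNEL `recordPvolAx`
# (Cauchy in the volume exponent `K` ⇒ the limit exists, ℝ complete) — and the K0ᴬ door from «two-volume rate» ∧ (L-dec)′ ∧ P0

LANDED VERBATIM (declarations and proofs byte-identical; this one paragraph added) by porter PTC-1 g3 (`ymgap-nodeO-port-PTC-1`, O-8∕O-11 JOIN pen) as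
`Summits/QuantumFields/YangMills/Theorems/BalabanUVNodesK0AxJoinResidualLimHalf.lean` `--supports stmt-QuantumFields-27238 --as helper` on ★★★ director-ym g21 №521 (2)
(nodeO STATUS 2026-08-31T06:15:46Z: «GO — PTC-1 lands it as its OWN file …, not an append; S-wrap EXEMPT — a two-volume consecutive difference on the kernel letter, J5′»);
AUTHORSHIP = ★ P3 g88 (HOME `pub/ym-nodeO-ideate/nodeO-cover/P3-K0AxJoinResidualLimHalf-v1.lean` f0b826690e3cab6b · 115 l. · 3 thm · 0 def; farm rc 0 at P3's desk,
re-checked by PTC-1).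
Cell `ym-nodeO-ideate`, seat ★ P3 g88 (count-neutral sketch at authorship).  Builds on ✓p812643
`Summits/QuantumFields/YangMills/Theorems/BalabanUVNodesK0AxJoinResidualSplit.lean` (ab410463f5a13f19; §7b two-supplier frame).

WHAT THIS TYPES (the READING OF RECORD ★★★ №518 (1) «two-volume differences feed the (1.21) LIMIT only», by name): the weakest TWO-VOLUME input that yields
the (1.21) letter `RecordPolLimitOnRunsAx F a₀ ε₂₉ γ` is an EVENTUALLY-GEOMETRIC RATE ROW on consecutive volumes of the finite-volume KERNEL at each entry —
`∀ μ ν z, ∃ C r, r < 1 ∧ ∃ K₀, ∀ K ≥ K₀, |recordPvolAx … (K+1) μ ν z − recordPvolAx … K μ ν z| ≤ C·r^K` along every `]0, γ]`-run (no uniformity in `z`, `k` or the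
run is needed for EXISTENCE; uniformity matters only for the decay half (L-dec)).  [I] p.264 «This limit exists … by the localized representation (1.7)»: print's
reason is exactly a two-volume comparison with rate `exp(−c L^K)` ≤ C·r^K.  S-wrap: two-volume DIFFERENCES of the kernel — EXEMPT (★★★ №515 (2), J5′ №517 (1)).
* `polLimitExists_of_twoVolume_geomRate` — GENERIC over a `K`-indexed family of functionals (`Node00.PolLimitExists` from the rate row; `cauchySeq_of_le_geometric`
  on the `K₀`-shifted sequence, `cauchySeq_shift`, `cauchySeq_tendsto_of_complete`);
* `recordPolLimitOnRunsAx_of_twoVolumeGeomRate` — (L-lim) at the record from the rate row on `recordPvolAx` (definitionally `polWindow … (recordTermsAx …) …`);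
* ★★★ `record13SepCoPHInhabitedAx_of_twoVolumeRate_pvolDecayEv_tokFree` — K0ᴬ BY NAME from «two-volume rate row under the token-free JOIN antecedents, all small ε₂₉»
  ∧ (L-dec)′ ∧ (R-Uk) ∧ (R-Bg), via ✓`record13SepCoPHInhabitedAx_of_twoSuppliers_tokFree`.

HONEST FRAMING.  CONDITIONAL helpers; the rate row, (L-dec)′ and P0 are OPEN Bałaban-strength content ([I] (1.21) p.264, (4.37) p.291, (5.10) p.293; [15] (8)–(9)) —
displayed, not proved; nothing of Bałaban is asserted, ported, discharged or refuted; K0ᴬ stmt-QuantumFields-27238 OPEN; NODE O not inhabited (0∕1); COUNT 8∕28 ·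
K 1∕4 UNMOVED; finite `𝕋⁴_{L^K}` at fixed ε — NOT continuum ∕ ℝ⁴ ∕ OS; **the Yang–Mills mass gap (Clay) is NOT proved by any of this.**  No `sorry`, no new `def`,
`instance`, `axiom`, `notation`; standard axioms only.
-/

noncomputable section

open scoped BigOperators Matrix.Norms.L2Operator Topology
open Filter

namespace Summit.QuantumFields.YangMills.Theorems.K0AxJoinResidual

open Summit.QuantumFields.YangMills.Theorems.K0RecordFormatNames
open Summit.QuantumFields.YangMills.Theorems
open Summit.QuantumFields.YangMills.Theorems.PortHRecordJoin
open Literature.MathematicalPhysics.QuantumFieldTheory.Balaban1983to89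
open Literature.MathematicalPhysics.QuantumFieldTheory.Balaban1983to89.Node00
open Literature.MathematicalPhysics.QuantumFieldTheory.Balaban1983to89.T4Continuum (T4Family)
open Literature.MathematicalPhysics.QuantumFieldTheory.Balaban1983to89.FlowStep
open Literature.MathematicalPhysics.QuantumFieldTheory.Balaban1983to89.FlowStepRuns

/-! ## §7c  (L-lim) from a two-volume geometric rate row -/

section Generic

variable {𝔄 : Type*} [NormedRing 𝔄] [NormedAlgebra ℝ 𝔄]
variable {V : Type*} [NormedAddCommGroup V] [NormedSpace ℝ V] {ι : Type*} [Fintype ι]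

/-- **The (1.21) existence letter of ONE `K`-indexed family from an eventually-geometric TWO-VOLUME rate at each entry `(μ, ν, z)`** (Cauchy ⇒ convergent in ℝ).
[cite: Balaban1987RG1, (1.21) p.264 («This limit exists»), (1.7) p.261] -/
theorem polLimitExists_of_twoVolume_geomRate (F : T4Family) (j : ℕ)
    (𝓔 : (K : ℕ) → ((Fin (F.P K).d → Site (F.P K) j → 𝔄) → ℝ)) (ρ : V →L[ℝ] 𝔄) (bV : Module.Basis ι ℝ V)
    (h : ∀ (μ ν : Fin 4) (z : Fin 4 → ℤ), ∃ C r : ℝ, r < 1 ∧ ∃ K₀ : ℕ, ∀ K : ℕ, K₀ ≤ K →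
      |polWindow F (K + 1) j (𝓔 (K + 1)) ρ bV μ ν z - polWindow F K j (𝓔 K) ρ bV μ ν z| ≤ C * r ^ K) :
    PolLimitExists F j 𝓔 ρ bV := by
  intro μ ν z
  obtain ⟨C, r, hr, K₀, hK⟩ := h μ ν z
  have hc : CauchySeq (fun n : ℕ => (fun K : ℕ => polWindow F K j (𝓔 K) ρ bV μ ν z) (n + K₀)) := by
    refine cauchySeq_of_le_geometric r (C * r ^ K₀) hr (fun n => ?_)
    have h1 : |polWindow F (n + K₀ + 1) j (𝓔 (n + K₀ + 1)) ρ bV μ ν z - polWindow F (n + K₀) j (𝓔 (n + K₀)) ρ bV μ ν z| ≤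
        C * r ^ K₀ * r ^ n :=
      calc |polWindow F (n + K₀ + 1) j (𝓔 (n + K₀ + 1)) ρ bV μ ν z - polWindow F (n + K₀) j (𝓔 (n + K₀)) ρ bV μ ν z|
          ≤ C * r ^ (n + K₀) := hK (n + K₀) (Nat.le_add_left K₀ n)
        _ = C * r ^ K₀ * r ^ n := by rw [pow_add]; ring
    show dist (polWindow F (n + K₀) j (𝓔 (n + K₀)) ρ bV μ ν z) (polWindow F (n + 1 + K₀) j (𝓔 (n + 1 + K₀)) ρ bV μ ν z) ≤ C * r ^ K₀ * r ^ n
    rw [Real.dist_eq, abs_sub_comm, Nat.add_right_comm n 1 K₀]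
    exact h1
  exact cauchySeq_tendsto_of_complete ((cauchySeq_shift K₀).mp hc)

end Generic

/-- **(L-lim) AT THE RECORD FROM A TWO-VOLUME GEOMETRIC RATE ROW ON THE KERNEL**: along every `]0, γ]`-run of the record's own (0.20), for every `k ≤ n` and every
entry `(μ, ν, z)`, an eventually-geometric rate on consecutive volumes of `recordPvolAx F a₀ ε₂₉ k (prefixOf gs k) · μ ν z` ⟹ `RecordPolLimitOnRunsAx F a₀ ε₂₉ γ`.
[cite: Balaban1987RG1, (1.21) p.264, (1.7) p.261, (0.20) p.256] -/
theorem recordPolLimitOnRunsAx_of_twoVolumeGeomRate (F : T4Family) (a₀ ε₂₉ : ℝ) {γ : ℝ}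
    (h : ∀ (n : ℕ) (gs : ℕ → ℝ), RGEqH n (betaOfRecord₁₃Ax F 2 (thetaFill F a₀ ε₂₉)) gs → Step.InInterval γ n gs → ∀ k, k ≤ n →
        ∀ (μ ν : Fin 4) (z : Fin 4 → ℤ), ∃ C r : ℝ, r < 1 ∧ ∃ K₀ : ℕ, ∀ K : ℕ, K₀ ≤ K →
          |recordPvolAx F a₀ ε₂₉ k (prefixOf gs k) (K + 1) μ ν z - recordPvolAx F a₀ ε₂₉ k (prefixOf gs k) K μ ν z| ≤ C * r ^ K) :
    RecordPolLimitOnRunsAx F a₀ ε₂₉ γ := by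
  intro n gs hrg hI k hk
  letI θ := thetaFill F a₀ ε₂₉
  letI := θ.instVβ₁; letI := θ.instVβ₂; letI := θ.instιβ
  exact polLimitExists_of_twoVolume_geomRate F (k + 1) (fun K => recordTermsAx F a₀ ε₂₉ k (prefixOf gs k) K) θ.ρ8 θ.bV
    (h n gs hrg hI k hk)

/-- ★★★ **THE TOKEN-FREE DOOR FROM «TWO-VOLUME RATE» ∧ (L-dec)′ ∧ P0**: under the token-free JOIN antecedents at cofinal cut-offs and for all sufficiently small `ε₂₉`,
(L-lim)″ «∃ γ₀ > 0, ∀ γ ≤ γ₀, the two-volume geometric rate row on the kernel `recordPvolAx`» and (L-dec)′ «…, the per-volume eventual (5.10) letter», together with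
(R-Uk) ∧ (R-Bg), give K0ᴬ BY NAME.  Every displayed object is S-wrap-EXEMPT (two-volume differences; the kernel letter; P0 binders).  CONDITIONAL helper; K0ᴬ OPEN;
the mass gap is NOT proved. [cite: Balaban1987RG1, Thm 1 p.259, Thm 3 p.264, (1.21)–(1.22) p.264, (4.37) p.291, (5.10) p.293; Balaban1985Variational, Thm 1 (8)–(9) p.279;
Balaban1988Convergent, Thm 1 p.262] -/
theorem record13SepCoPHInhabitedAx_of_twoVolumeRate_pvolDecayEv_tokFree
    (hRate : ∀ F : T4Family, ∃ Mth : ℕ, ∀ Mc : ℕ, Mth ≤ Mc → ∀ (j c c₀ c₁ : ℕ) (B₃ B₃' a₀ a₁ : ℝ), JoinAntecedents (fun _ _ _ => True) F Mc j c c₀ c₁ B₃ B₃' a₀ a₁ →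
      ∃ εL : ℝ, 0 < εL ∧ ∀ ε₂₉ : ℝ, 0 < ε₂₉ → ε₂₉ ≤ εL → ∃ γ₀ : ℝ, 0 < γ₀ ∧ ∀ γ : ℝ, γ ≤ γ₀ →
        ∀ (n : ℕ) (gs : ℕ → ℝ), RGEqH n (betaOfRecord₁₃Ax F 2 (thetaFill F a₀ ε₂₉)) gs → Step.InInterval γ n gs → ∀ k, k ≤ n →
          ∀ (μ ν : Fin 4) (z : Fin 4 → ℤ), ∃ C r : ℝ, r < 1 ∧ ∃ K₀ : ℕ, ∀ K : ℕ, K₀ ≤ K →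
            |recordPvolAx F a₀ ε₂₉ k (prefixOf gs k) (K + 1) μ ν z - recordPvolAx F a₀ ε₂₉ k (prefixOf gs k) K μ ν z| ≤ C * r ^ K)
    (hDec : ∀ F : T4Family, ∃ Mth : ℕ, ∀ Mc : ℕ, Mth ≤ Mc → ∀ (j c c₀ c₁ : ℕ) (B₃ B₃' a₀ a₁ : ℝ), JoinAntecedents (fun _ _ _ => True) F Mc j c c₀ c₁ B₃ B₃' a₀ a₁ →
      ∃ εD : ℝ, 0 < εD ∧ ∀ ε₂₉ : ℝ, 0 < ε₂₉ → ε₂₉ ≤ εD → ∃ γ₀ C δ₁ : ℝ, 0 < γ₀ ∧ ∀ γ : ℝ, γ ≤ γ₀ → RecordPvolDecayEvOnRunsAx F a₀ ε₂₉ γ C δ₁)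
    (hUk : ∀ F : T4Family, ∃ aU : ℝ, 0 < aU ∧ ∀ (B₃ a₀ a₁ : ℝ), 2 * (F.L : ℝ) ^ 2 ≤ B₃ → 0 < a₀ → a₀ ≤ aU → 0 < a₁ → ∃ M₀ : ℕ, ∀ Mc : ℕ, McGuard F Mc → M₀ ≤ Mc →
      (∀ ε₁ : ℝ, 0 < ε₁ → ε₁ ≤ a₁ → B₃ * ε₁ ≤ a₀ → ∀ (k n : ℕ) (V : Literature.MathematicalPhysics.QuantumFieldTheory.Balaban1983to89.GaugeField (F.P (Summit.QuantumFields.YangMills.Theorems.K0RecordFormatNames.recordK₀ F Mc k + n)) (k + 1) (Literature.MathematicalPhysics.QuantumFieldTheory.Balaban1983to89.Node00.SU 2)), Literature.MathematicalPhysics.QuantumFieldTheory.Balaban1983to89.PlaqSmall ε₁ V → Literature.MathematicalPhysics.QuantumFieldTheory.Balaban1983to89.Node00.UkExists F 2 (Summit.QuantumFields.YangMills.Theorems.K0RecordFormatNames.recordK₀ F Mc k + n) (k + 1) a₀ V ∧ Literature.MathematicalPhysics.QuantumFieldTheory.Balaban1983to89.Node00.UniqueUkOrbit F 2 (Summit.QuantumFields.YangMills.Theorems.K0RecordFormatNames.recordK₀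 F Mc k + n) (k + 1) a₀ V))
    (hBg : ∀ F : T4Family, ∃ aB : ℝ, 0 < aB ∧ ∀ a₀ : ℝ, 0 < a₀ → a₀ ≤ aB → ∃ M₀ : ℕ, ∀ Mc : ℕ, McGuard F Mc → M₀ ≤ Mc →
      (∀ (k n : ℕ) (ε₂₉ : ℝ), 0 < ε₂₉ → letI θ := Summit.QuantumFields.YangMills.Theorems.K0RecordFormatNames.thetaFill F a₀ ε₂₉; letI := θ.instVβ₁; letI := θ.instVβ₂; letI := θ.instιβ; AnalyticAt ℝ (fun B : Summit.QuantumFields.YangMills.Theorems.K0RecordFormatNames.recordW F a₀ ε₂₉ k (Summit.QuantumFields.YangMills.Theorems.K0RecordFormatNames.recordK₀ F Mc k + n) => fun (b : Literature.MathematicalPhysics.QuantumFieldTheory.Balaban1983to89.PBond (F.P (Summit.QuantumFields.YangMills.Theorems.K0RecordFormatNames.recordK₀ F Mc k + n)) 0) (i i' : Fin 2) => ((Summit.QuantumFields.YangMills.Theorems.K0RecordFormatNames.recordBgField F θ k (Summit.QuantumFields.YangMills.Theorems.K0RecordFormatNames.recordK₀ F Mc k + n) B b : Literature.MathematicalPhysics.QuantumFieldTheory.Balaban1983to89.Node00.SU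 2) : Matrix (Fin 2) (Fin 2) ℂ) i i') 0)) :
    Summit.QuantumFields.YangMills.Theses.BalabanUVNodes.Record13SepCoPHInhabitedAx := by
  refine record13SepCoPHInhabitedAx_of_twoSuppliers_tokFree (fun F => ?_) hDec hUk hBg
  obtain ⟨Mth, hM⟩ := hRate F
  refine ⟨Mth, fun Mc hMc j c c₀ c₁ B₃ B₃' a₀ a₁ hA => ?_⟩
  obtain ⟨εL, hεL, hL⟩ := hM Mc hMc j c c₀ c₁ B₃ B₃' a₀ a₁ hA
  refine ⟨εL, hεL, fun ε₂₉ hε hεle => ?_⟩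
  obtain ⟨γ₀, hγ₀, hγ⟩ := hL ε₂₉ hε hεle
  exact ⟨γ₀, hγ₀, fun γ hγle => recordPolLimitOnRunsAx_of_twoVolumeGeomRate F a₀ ε₂₉ (hγ γ hγle)⟩

end Summit.QuantumFields.YangMills.Theorems.K0AxJoinResidual

end
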